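import Summits.Schanuel.Schanuel.Theorems.ZilberEacNearResonantSystem
import Summits.Schanuel.Schanuel.Theorems.ZilberEacNearResonantLabels
import Mathlib.Analysis.SpecialFunctions.Complex.Log
import HarnessLib

/-!
# The near-resonant regime: honest solutions of `e^{xⱼ} = xⱼ + e^{r₀x₀ + (1-r₀)x₁}` along
# near-resonant labels, with their asymptotics

Zilber's Exponential-Algebraic Closedness, case ladder (host summit Schanuel, cell `pub-schanuel`,
seat 2, gen 13).  THE CRITICAL-SIZE FAMILY of O54 (a):
`W_r = {x₂ = r₀x₀ + (1 - r₀)x₁, y₀ = x₀ + y₂, y₁ = x₁ + y₂}`.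

**THEOREM (`exists_solutions_nearResonant`).**  Let `r₀ ∉ {0, 1}`, `σ ≠ 0`, and let
`q = (δ₀*, δ₁*, τ*)` be a base point of the rescaled system `nrF` at a real parameter `ε*`
(`e^{δⱼ*} = 1 + Aⱼσ`, `e^{-τ*} = σ`, `r₀δ₀* + (1-r₀)δ₁* + 2πiε* = 0`; supplied by
`ZilberEacNearResonantLimit.nrF_basePoint`).  For every sequence of labels `d_k → ∞`, `n₁(k) ∈ ℤ`
with `r₀ d_k + n₁(k) → ε*` (supplied by `ZilberEacNearResonantLabels.exists_labels_tendsto`) there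
are `x(k) ∈ ℂ²` such that, for all large `k`,

  `e^{x(k)ⱼ} = x(k)ⱼ + e^{ξ_k}`,  `ξ_k = r₀ x(k)₀ + (1 - r₀) x(k)₁`  (`j = 0, 1`),

i.e. `(x(k), ξ_k; e^{x(k)}, e^{ξ_k}) ∈ W_r ∩ Γ_exp`, and

  `ξ_k / log d_k → 1`,  `x(k)₀ / d_k → 2πi(1 - r₀)`,  `e^{ξ_k} / d_k → e^{τ*} = 1/σ`.

Construction: `(δ₀, δ₁, τ)(k) = ψ(r₀d_k + n₁(k), 1/d_k, log d_k/d_k)` with `ψ` the implicit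
function of `ZilberEacNearResonantSystem.exists_implicit_nearResonant` (its partial derivative is
injective by `nrL_injective`: `σ ≠ 0`, `A₀A₁ ≠ 0`, `r₀ + r₁ = 1`, `r₀A₀ + r₁A₁ = 0`), then
`ξ_k = log d_k + τ(k)`, `x(k)ⱼ = ξ_k + 2πi nⱼ(k) + δⱼ(k)` with `n₀ = d + n₁`; the three rescaled
equations are EXACTLY `e^{xⱼ} = xⱼ + e^{ξ}` and `r·x = ξ` after multiplication by `d_k e^{τ}`.
This is a NEW solution regime ("near-resonant all-fast balance along the irrational real plane"):
the solutions accumulate along the real direction `(1 - r₀, -r₀)` of the lattice, not along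
rational rays, and `y₂ = e^{x₂}` has the SAME size as the targets (critical size).

HONEST FRAMING: an existence theorem for explicit members of an OPEN cell (`ECCell 3 2`);
NOT Schanuel's conjecture; EAC ⇏ SC.
-/

noncomputable section

open Complex Filter Topology

set_option linter.dupNamespace false

namespace Summit.Schanuel.Schanuel.Theorems

section Existence

/-- The parameter sequence `(r₀d_k + n₁(k), 1/d_k, log d_k / d_k) → (ε*, 0, 0)`. [folklore] -/
theorem tendsto_nearResonant_params {r₀ εst : ℝ} {d : ℕ → ℕ} {n₁ : ℕ → ℤ}
    (hd : Tendsto d atTop atTop) (hε : Tendsto (fun k => r₀ * d k + n₁ k) atTop (𝓝 εst)) :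
    Tendsto (fun k => ((((r₀ * d k + n₁ k : ℝ)) : ℂ), (((1 / (d k : ℝ) : ℝ)) : ℂ),
      (((Real.log (d k) / (d k : ℝ) : ℝ)) : ℂ))) atTop (𝓝 (((εst : ℂ), 0, 0) : ℂ × ℂ × ℂ)) := by
  refine Tendsto.prodMk_nhds ((continuous_ofReal.tendsto _).comp hε)
    (Tendsto.prodMk_nhds ?_ ?_)
  · have h := (continuous_ofReal.tendsto (0 : ℝ)).comp (tendsto_one_div_atTop_nhds_zero_nat.comp hd)
    rw [ofReal_zero] at h
    exact h
  · have h := (continuous_ofReal.tendsto (0 : ℝ)).comp (tendsto_log_pow_div_natCast_comp hd 1)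
    rw [ofReal_zero] at h
    refine h.congr fun k => ?_
    simp only [Function.comp_apply, pow_one]

/-- **THEOREM (near-resonant solutions at critical size, with asymptotics).**  See the module
docstring. (new) [cite: MantovaMasser2023, §1 p.5 (the open case dim π(V) = 2 in ℂ³×ℂˣ³)] -/
theorem exists_solutions_nearResonant (r₀ : ℝ) (h0 : r₀ ≠ 0) (h1 : r₀ ≠ 1) {σ : ℂ} (hσ : σ ≠ 0)
    {q : ℂ × ℂ × ℂ} {εst : ℝ}
    (he₀ : exp q.1 = 1 + 2 * Real.pi * I * ((1 - r₀ : ℝ) : ℂ) * σ)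
    (he₁ : exp q.2.1 = 1 + -(2 * Real.pi * I * (r₀ : ℂ)) * σ) (hτ : exp (-q.2.2) = σ)
    (hq : nrF (r₀ : ℂ) ((1 - r₀ : ℝ) : ℂ) (2 * Real.pi * I * ((1 - r₀ : ℝ) : ℂ))
      (-(2 * Real.pi * I * (r₀ : ℂ))) (2 * Real.pi * I) (((εst : ℂ), 0, 0), q) = 0)
    {d : ℕ → ℕ} {n₁ : ℕ → ℤ} (hd : Tendsto d atTop atTop)
    (hε : Tendsto (fun k => r₀ * d k + n₁ k) atTop (𝓝 εst)) :
    ∃ x : ℕ → Fin 2 → ℂ,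
      (∀ᶠ k in atTop, ∀ j : Fin 2,
        exp (x k j) = x k j + exp (∑ i, ((![r₀, 1 - r₀] : Fin 2 → ℝ) i : ℂ) * x k i)) ∧
      Tendsto (fun k => (∑ i, ((![r₀, 1 - r₀] : Fin 2 → ℝ) i : ℂ) * x k i) / (Real.log (d k) : ℂ))
        atTop (𝓝 1) ∧
      Tendsto (fun k => x k 0 / (d k : ℂ)) atTop (𝓝 (2 * Real.pi * I * ((1 - r₀ : ℝ) : ℂ))) ∧
      Tendsto (fun k => exp (∑ i, ((![r₀, 1 - r₀] : Fin 2 → ℝ) i : ℂ) * x k i) / (d k : ℂ))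
        atTop (𝓝 (exp q.2.2)) := by
  have hπ := Real.pi_pos
  -- names for the constants
  set A₀ : ℂ := 2 * Real.pi * I * ((1 - r₀ : ℝ) : ℂ) with hA₀
  set A₁ : ℂ := -(2 * Real.pi * I * (r₀ : ℂ)) with hA₁
  set B : ℂ := 2 * Real.pi * I with hB
  set r₁ : ℂ := ((1 - r₀ : ℝ) : ℂ) with hr₁
  have h2πI : (2 * Real.pi * I : ℂ) ≠ 0 := Complex.two_pi_I_ne_zero
  have hA₀0 : A₀ ≠ 0 := mul_ne_zero h2πI (by
    rw [Ne, ofReal_eq_zero, sub_eq_zero]; exact Ne.symm h1)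
  have hA₁0 : A₁ ≠ 0 := neg_ne_zero.2 (mul_ne_zero h2πI (ofReal_ne_zero.2 h0))
  have hsum : (r₀ : ℂ) + r₁ ≠ 0 := by
    rw [hr₁]; push_cast; norm_num
  have hcrit : (r₀ : ℂ) * A₀ + r₁ * A₁ = 0 := by
    rw [hA₀, hA₁, hr₁]; push_cast; ring
  -- the implicit function
  have hinj : Function.Injective
      (nrL (exp q.1) (exp q.2.1) (exp (-q.2.2) * A₀) (exp (-q.2.2) * A₁) (r₀ : ℂ) r₁) := by
    rw [hτ]
    exact nrL_injective hσ hA₀0 hA₁0 hsum hcrit he₀ he₁ (Complex.exp_ne_zero _)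
      (Complex.exp_ne_zero _)
  obtain ⟨ψ, hψsol, hψlim⟩ := exists_implicit_nearResonant (r₀ : ℂ) r₁ A₀ A₁ B (εst : ℂ) q hq hinj
  -- the parameter sequence and the rescaled solutions
  set p : ℕ → ℂ × ℂ × ℂ := fun k => ((((r₀ * d k + n₁ k : ℝ)) : ℂ), (((1 / (d k : ℝ) : ℝ)) : ℂ),
    (((Real.log (d k) / (d k : ℝ) : ℝ)) : ℂ)) with hp
  have hpt : Tendsto p atTop (𝓝 (((εst : ℂ), 0, 0) : ℂ × ℂ × ℂ)) := tendsto_nearResonant_params hd hε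
  have hqs : Tendsto (fun k => ψ (p k)) atTop (𝓝 q) := hψlim.comp hpt
  have hsol : ∀ᶠ k in atTop, nrF (r₀ : ℂ) r₁ A₀ A₁ B (p k, ψ (p k)) = 0 := hpt.eventually hψsol
  -- the solutions
  set ξ : ℕ → ℂ := fun k => (Real.log (d k) : ℂ) + (ψ (p k)).2.2 with hξ
  set x : ℕ → Fin 2 → ℂ := fun k =>
    ![ξ k + 2 * Real.pi * I * ((d k : ℂ) + (n₁ k : ℂ)) + (ψ (p k)).1,
      ξ k + 2 * Real.pi * I * (n₁ k : ℂ) + (ψ (p k)).2.1] with hx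
  have hd1 : ∀ᶠ k in atTop, 1 ≤ d k := hd.eventually_ge_atTop 1
  -- the three rescaled equations, unfolded
  have heqs : ∀ᶠ k in atTop,
      exp (ψ (p k)).1 = 1 + exp (-(ψ (p k)).2.2) * (A₀ + (((Real.log (d k) / (d k : ℝ) : ℝ)) : ℂ) +
        (((1 / (d k : ℝ) : ℝ)) : ℂ) * (B * (((r₀ * d k + n₁ k : ℝ)) : ℂ) + (ψ (p k)).2.2 +
          (ψ (p k)).1)) ∧
      exp (ψ (p k)).2.1 = 1 + exp (-(ψ (p k)).2.2) * (A₁ + (((Real.log (d k) / (d k : ℝ) : ℝ)) : ℂ) +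
        (((1 / (d k : ℝ) : ℝ)) : ℂ) * (B * (((r₀ * d k + n₁ k : ℝ)) : ℂ) + (ψ (p k)).2.2 +
          (ψ (p k)).2.1)) ∧
      (r₀ : ℂ) * (ψ (p k)).1 + r₁ * (ψ (p k)).2.1 + B * (((r₀ * d k + n₁ k : ℝ)) : ℂ) = 0 := by
    filter_upwards [hsol] with k hk
    simp only [nrF, hp, Prod.mk_eq_zero] at hk
    obtain ⟨hk0, hk1, hk2⟩ := hk
    exact ⟨by linear_combination hk0, by linear_combination hk1, hk2⟩
  -- the hyperplane constraint `r·x = ξ`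
  have hlin : ∀ᶠ k in atTop, (∑ i, ((![r₀, 1 - r₀] : Fin 2 → ℝ) i : ℂ) * x k i) = ξ k := by
    filter_upwards [heqs] with k hk
    obtain ⟨-, -, hk2⟩ := hk
    rw [Fin.sum_univ_two]
    simp only [hx, Matrix.cons_val_zero, Matrix.cons_val_one]
    rw [hB, hr₁] at hk2
    push_cast at hk2 ⊢
    linear_combination hk2
  -- limits of the components of the rescaled solutions
  have hδ₀lim : Tendsto (fun k => (ψ (p k)).1) atTop (𝓝 q.1) := (continuous_fst.tendsto q).comp hqs
  have hδ₁lim : Tendsto (fun k => (ψ (p k)).2.1) atTop (𝓝 q.2.1) :=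
    (continuous_fst.tendsto q.2).comp ((continuous_snd.tendsto q).comp hqs)
  have hτlim : Tendsto (fun k => (ψ (p k)).2.2) atTop (𝓝 q.2.2) :=
    (continuous_snd.tendsto q.2).comp ((continuous_snd.tendsto q).comp hqs)
  -- the small real sequences, as complex numbers
  have hs0 : Tendsto (fun k => (((1 / (d k : ℝ) : ℝ)) : ℂ)) atTop (𝓝 0) := by
    have h := (continuous_ofReal.tendsto (0 : ℝ)).comp (tendsto_one_div_atTop_nhds_zero_nat.comp hd)
    rw [ofReal_zero] at h
    exact h
  have hl0 : Tendsto (fun k => (((Real.log (d k) / (d k : ℝ) : ℝ)) : ℂ)) atTop (𝓝 0) := by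
    have h := (continuous_ofReal.tendsto (0 : ℝ)).comp (tendsto_log_pow_div_natCast_comp hd 1)
    rw [ofReal_zero] at h
    refine h.congr fun k => ?_
    simp only [Function.comp_apply, pow_one]
  have hLinv0 : Tendsto (fun k => (((Real.log (d k))⁻¹ : ℝ) : ℂ)) atTop (𝓝 0) := by
    have h := (continuous_ofReal.tendsto (0 : ℝ)).comp
      (tendsto_inv_atTop_zero.comp (tendsto_log_natCast_comp hd))
    rw [ofReal_zero] at h
    exact h
  have hεC : Tendsto (fun k => (((r₀ * d k + n₁ k : ℝ)) : ℂ)) atTop (𝓝 (εst : ℂ)) :=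
    (continuous_ofReal.tendsto _).comp hε
  have hL1 : ∀ᶠ k in atTop, 1 ≤ Real.log (d k) := (tendsto_log_natCast_comp hd).eventually_ge_atTop 1
  refine ⟨x, ?_, ?_, ?_, ?_⟩
  · -- (a) honest solutions
    filter_upwards [heqs, hlin, hd1] with k hk hlk hdk
    obtain ⟨hk0, hk1, -⟩ := hk
    rw [hlk]
    have hdpos : (0 : ℝ) < (d k : ℝ) := by exact_mod_cast hdk
    have hdC : (d k : ℂ) ≠ 0 := by exact_mod_cast (show d k ≠ 0 by omega)
    have hexpL : exp ((Real.log (d k) : ℝ) : ℂ) = (d k : ℂ) := by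
      rw [← Complex.ofReal_exp, Real.exp_log hdpos]
      push_cast
      rfl
    have hexpξ : exp (ξ k) = (d k : ℂ) * exp (ψ (p k)).2.2 := by
      simp only [hξ]
      rw [Complex.exp_add, hexpL]
    have hττ : exp (ψ (p k)).2.2 * exp (-(ψ (p k)).2.2) = 1 := by
      rw [← Complex.exp_add, add_neg_cancel, Complex.exp_zero]
    have hinv : (d k : ℂ) * (1 / (d k : ℂ)) = 1 := by field_simp
    have hn0 : exp (2 * Real.pi * I * ((d k : ℂ) + (n₁ k : ℂ))) = 1 := by
      have := Complex.exp_int_mul_two_pi_mul_I ((d k : ℤ) + n₁ k)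
      rw [← this]; congr 1; push_cast; ring
    have hn1 : exp (2 * Real.pi * I * (n₁ k : ℂ)) = 1 := by
      have := Complex.exp_int_mul_two_pi_mul_I (n₁ k)
      rw [← this]; congr 1; ring
    have hs : (((1 / (d k : ℝ) : ℝ)) : ℂ) = 1 / (d k : ℂ) := by push_cast; rfl
    have hl : (((Real.log (d k) / (d k : ℝ) : ℝ)) : ℂ) =
        ((Real.log (d k) : ℝ) : ℂ) * (1 / (d k : ℂ)) := by
      rw [Complex.ofReal_div]
      push_cast
      ring
    have hεk : B * (((r₀ * d k + n₁ k : ℝ)) : ℂ) =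
        2 * Real.pi * I * ((r₀ : ℂ) * (d k : ℂ) + (n₁ k : ℂ)) := by
      rw [hB]; push_cast; ring
    rw [hs, hl, hεk] at hk0 hk1
    intro j
    fin_cases j
    · simp only [hx, Fin.zero_eta, Matrix.cons_val_zero]
      rw [Complex.exp_add, Complex.exp_add, hn0, mul_one, hk0, hexpξ]
      simp only [hξ, hA₀, hr₁, hB]
      push_cast
      linear_combination ((d k : ℂ) * (2 * Real.pi * I * (1 - (r₀ : ℂ))) +
          (d k : ℂ) * (1 / (d k : ℂ)) * (Complex.log ((d k : ℕ) : ℂ) +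
            2 * Real.pi * I * ((r₀ : ℂ) * (d k : ℂ) + (n₁ k : ℂ)) +
            (ψ (p k)).2.2 + (ψ (p k)).1)) * hττ +
        (Complex.log ((d k : ℕ) : ℂ) + 2 * Real.pi * I * ((r₀ : ℂ) * (d k : ℂ) + (n₁ k : ℂ)) +
          (ψ (p k)).2.2 + (ψ (p k)).1) * hinv
    · simp only [hx, Fin.mk_one, Matrix.cons_val_one, Matrix.cons_val_zero]
      rw [Complex.exp_add, Complex.exp_add, hn1, mul_one, hk1, hexpξ]
      simp only [hξ, hA₁, hB]
      push_cast
      linear_combination ((d k : ℂ) * (-(2 * Real.pi * I * (r₀ : ℂ))) +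
          (d k : ℂ) * (1 / (d k : ℂ)) * (Complex.log ((d k : ℕ) : ℂ) +
            2 * Real.pi * I * ((r₀ : ℂ) * (d k : ℂ) + (n₁ k : ℂ)) +
            (ψ (p k)).2.2 + (ψ (p k)).2.1)) * hττ +
        (Complex.log ((d k : ℕ) : ℂ) + 2 * Real.pi * I * ((r₀ : ℂ) * (d k : ℂ) + (n₁ k : ℂ)) +
          (ψ (p k)).2.2 + (ψ (p k)).2.1) * hinv
  · -- (b) `ξ_k / log d_k → 1`
    have hlim : Tendsto (fun k => 1 + (ψ (p k)).2.2 * (((Real.log (d k))⁻¹ : ℝ) : ℂ)) atTop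
        (𝓝 (1 + q.2.2 * 0)) := tendsto_const_nhds.add (hτlim.mul hLinv0)
    rw [mul_zero, add_zero] at hlim
    refine hlim.congr' ?_
    filter_upwards [hlin, hL1] with k hlk hLk
    rw [hlk]
    have hL0 : ((Real.log (d k) : ℝ) : ℂ) ≠ 0 := ofReal_ne_zero.2 (by linarith)
    simp only [hξ]
    rw [Complex.ofReal_inv]
    field_simp
  · -- (c) `x(k)₀ / d_k → 2πi(1 - r₀)`
    have hlim : Tendsto (fun k => 2 * Real.pi * I * ((1 - r₀ : ℝ) : ℂ) +
        ((((Real.log (d k) / (d k : ℝ) : ℝ)) : ℂ) + (ψ (p k)).2.2 * (((1 / (d k : ℝ) : ℝ)) : ℂ) +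
          2 * Real.pi * I * ((((r₀ * d k + n₁ k : ℝ)) : ℂ) * (((1 / (d k : ℝ) : ℝ)) : ℂ)) +
          (ψ (p k)).1 * (((1 / (d k : ℝ) : ℝ)) : ℂ))) atTop
        (𝓝 (2 * Real.pi * I * ((1 - r₀ : ℝ) : ℂ) +
          (0 + q.2.2 * 0 + 2 * Real.pi * I * ((εst : ℂ) * 0) + q.1 * 0))) :=
      tendsto_const_nhds.add (((hl0.add (hτlim.mul hs0)).add
        (tendsto_const_nhds.mul (hεC.mul hs0))).add (hδ₀lim.mul hs0))
    simp only [mul_zero, add_zero] at hlim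
    refine hlim.congr' ?_
    filter_upwards [hd1] with k hdk
    have hdC : (d k : ℂ) ≠ 0 := by exact_mod_cast (show d k ≠ 0 by omega)
    simp only [hx, hξ, Matrix.cons_val_zero]
    push_cast
    field_simp
    ring
  · -- (d) `e^{ξ_k} / d_k → e^{τ*}`
    have hlim : Tendsto (fun k => exp (ψ (p k)).2.2) atTop (𝓝 (exp q.2.2)) :=
      (Complex.continuous_exp.tendsto _).comp hτlim
    refine hlim.congr' ?_
    filter_upwards [hlin, hd1] with k hlk hdk
    rw [hlk]
    have hdpos : (0 : ℝ) < (d k : ℝ) := by exact_mod_cast hdk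
    have hdC : (d k : ℂ) ≠ 0 := by exact_mod_cast (show d k ≠ 0 by omega)
    have hexpL : exp ((Real.log (d k) : ℝ) : ℂ) = (d k : ℂ) := by
      rw [← Complex.ofReal_exp, Real.exp_log hdpos]
      push_cast
      rfl
    simp only [hξ]
    rw [Complex.exp_add, hexpL]
    field_simp

end Existence

end Summit.Schanuel.Schanuel.Theorems

end
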